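/-
Copyright (c) 2026 the pub-hodgecm-mathlib formalisation cell (harness21).  Prover seat hodgecm-mathlib-K2Liu-p25 (g4), Track B «K2-LIT» ∕ hLiu418 #184♮ =
`stmt-HodgeConjecture-24832`, Road I v3, #42F′ — PIN′ PART A (LEAD F0P6-plan (g16) BATCH #288 (3), K2 bus 2026-09-05T03:37:38Z): the (PIN′) slot of the #42F′ kit
(binder 0 `hpin'` of ★ p863161 `K2LiuHolOnSpanOfPoleSet.hHol''_of_poleSet'_and_vanishing`, = K2E3-typ3 (g3) v12 `slot_pinP`) FROM THE PINNED SOCKET #41.  THEOREMS ONLY.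
-/
import Summits.HodgeConjecture.HodgeConjecture.Theorems.K2LiuHolOnSpanOfPoleSet          -- ★ p863161 the CONSUMER `hHol''_of_poleSet'_and_vanishing (hpin') (hvan')` (its binder-0 bytes are this file's conclusion)
import Summits.HodgeConjecture.HodgeConjecture.Theorems.K2LiuSiegelWeilTensorGenerator   -- ★ p857010 `isStandardSectionFamily_swTensorTwisted`, `continuous_swTensorTwisted` (the twisted Siegel–Weil generator is STANDARD + continuous on `K`-finite `Φ`)
import Summits.HodgeConjecture.HodgeConjecture.Theorems.K2LiuTensorEmbArchFinParts      -- ★ U2f ⇒ `finiteDimensional_span_orbit_of_mem_span_tmul_of_isStd` (`K`-finiteness of every `x ∈ D_V` under `harch`, standard `𝒦`)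
import HarnessLib

/-!
# K2_Liu road (hLiu418), Road I v3, #42F′ — PIN′ PART A: `pinPrime_of_pinnedSocket41` — (PIN′) ⟸ THE PINNED SOCKET #41

Cell `pub/hodgecm-mathlib` (D-0151), Track B, build stream 29; helper lane `--kind proof --supports stmt-HodgeConjecture-24832 --as helper` (count-neutral; closes no socket).
THEOREMS ONLY (no `def`, no `instance`, no notation, no named-fact hypothesis, no `sorry`).

WHAT.  (PIN′) — binder 0 `hpin'` of ★ p863161 `K2LiuHolOnSpanOfPoleSet.hHol''_of_poleSet'_and_vanishing` (bytes :62–:102 VERBATIM below as the conclusion; = the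
`sorry` slot `slot_pinP : arg_type% K2LiuHolOnSpanOfPoleSet.hHol''_of_poleSet'_and_vanishing 0` of K2E3-typ3 (g3)'s #42F′ tie probe v12 `TieProbe_42F.v12_negKeyed` :168)
— says: for the #42F′ frame (`n = 2` by `e`, `λ` conjugate-symplectic of weight 1, the big frame `(eW, e′, dV′)` with `dV′` ANISOTROPIC, the det-twist equation
`χ_b³·α̃ = λ̃⁻¹`, a STANDARD Iwasawa datum `𝒦`), on the rigidity domain `D_V = span{a ⊗ f ∣ a ∈ V}` of any finite-dimensional archimedean-stable `V` (`harch`), the twisted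
Siegel–Weil family `g_x(s,h) = detChar α h · stdExt_𝒦^{(3−n)∕2}(swSectionTensor … x)(s,h)` of every `x ∈ D_V` has a continuation `Es` with socket #41's five clauses and the
pole set `P := {½}` LITERAL.

CENSUS VERDICT (LEAD's ONE question «does PIN′ follow from #41 as stated?»): from the UNPINNED U6 socket #41 `sig_K2LiuSiegelEisensteinContinuation` (U6 ED. 12 :289, `∃ (P :
Finset ℂ) Es, …`) it does NOT follow without the letter «the pole set of `g_x` on `{0 < re s}` is `⊆ {½}`» (P is arbitrary there, and clause (iv) pins `Es` only on `{n∕2 <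
re s}`, so `(s−½)·Es∕∏_{p∈P}(s−p)` need not extend across `P ∖ {½}`); from the PINNED reading of socket #41 — K2E3-typ2 (g3)'s cert head `tieProbe_41pin_ed20w…`
(`TieProbe_41.v42ped20w….lean` :295–:311: the SAME binders, conclusion `∃ Es, …` with `∏ p ∈ ({(1 / 2 : ℂ)} : Finset ℂ), (s - p)`; the #41 payer road proves exactly this
form through ★ p863126 (T′) `continuation_of_archReference_poleSet` and ★ p863019∕p862974 `siegelEisensteinContinuation_twenty_poleSet`) — it DOES, by ONE application at
`f := g_x`, whose two side conditions are ★: `g_x` is a STANDARD family for `(𝒦, λ̃⁻¹)` (★ `isStandardSectionFamily_swTensorTwisted` at `M₂ = 3` under `rw [hχD]`, its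
`K`-finiteness input ★ `finiteDimensional_span_orbit_of_mem_span_tmul_of_isStd … h𝒦 hsB V harch x.2`, `hsB` = ★ `isDoubledWeilRep_doubledWeilRep`) and continuous in `h`
for every `s` (★ `continuous_swTensorTwisted`) — the road of ★ p863086 `K2LiuResidueArchDerivRow` :170–:204, now at the literal exponent `(3 − n)∕2` (no `n = 2` cast needed:
both sides carry the same `{n} (e : Fin 2 × Fin 1 ≃ Fin n)`).

THIS FILE: **`pinPrime_of_pinnedSocket41 (h41p : ‹PINNED #41, typ2 :296–:311 bytes, `IdeleClassGroup` qualified as in ★ p863086's `h41`›) : ‹PIN′ = ★ p863161 binder 0 bytes›`**.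
TIE (typ3 v13+): `slot_pinP := K2LiuPinPrimeOfPinnedSocket41.pinPrime_of_pinnedSocket41 ‹typ2's pinned #41 head›`; #42F′'s payer-level residual loses its PIN′ line; the
pinned #41 head itself stays BY VALUE until typ2's cert is sorry-free (its residue = the K1-b♮ ∕ K1-a♮ slots of record).
HONEST LABEL: HC_CM is proved only modulo the 7 printed citations (2 remaining named inputs: hLiu418 = `stmt-HodgeConjecture-24832`, h413 = `stmt-HodgeConjecture-24833`)
until rung 0 closes; an adapter pays nothing by itself — (PIN′) is open until the pinned socket #41 lands.
References: [KudlaRallis1994] S. Kudla, S. Rallis, *A regularized Siegel–Weil formula: the first term identity*, Ann. of Math. 140 (1994), §1 Thm. 1.1; [Tan1999] V. Tan,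
*Poles of Siegel Eisenstein series on U(n,n)*, Canad. J. Math. 51 (1999), §1 Main Theorem p. 166, §4; [Liu2021] Y. Liu, App. B Lem. B.10 (2) p. 102, Lem. B.12 pp. 103–104;
[MoeglinWaldspurger1995] IV.1.8–IV.1.11.
-/

set_option autoImplicit false
set_option linter.dupNamespace false -- the mandated namespace repeats `HodgeConjecture.HodgeConjecture`

noncomputable section

open scoped BigOperators Matrix Topology TensorProduct SchwartzMap Classical
open NumberField NumberField.mixedEmbedding IsDedekindDomain MeasureTheory Filter

namespace Summit.HodgeConjecture.HodgeConjecture.Cruxes.HLiu418.K2LiuPinPrimeOfPinnedSocket41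

open Literature.NumberTheory.Automorphic Literature.NumberTheory.Automorphic.UnitaryGroup Literature.NumberTheory.GaloisRepresentations
open Literature.NumberTheory.GelbartRogawski1991 Literature.NumberTheory.GelbartRogawski1991.GRConstruction
open Literature.NumberTheory.GelbartRogawski1991.UnitaryDualPair
open Literature.NumberTheory.K2Lit.SiegelDoubled Literature.NumberTheory.K2Lit.DoubledLineTheta
open Literature.NumberTheory.Automorphic.IdeleClassGroup
open Literature.NumberTheory.Automorphic.Liu2021
open Literature.NumberTheory.Automorphic.Liu2021.Def411WeilCarriers
open Literature.NumberTheory.Automorphic.Liu2021.Def411WeilCarriersDoubling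
open Literature.NumberTheory.Weil1964
open Literature.RepresentationTheory.Liu2021
open Literature.RepresentationTheory.HarrisKudlaSweet1996 (IsSplittingChar)
open Summit.HodgeConjecture.HodgeConjecture.Cruxes.HLiu418.K2LiuSiegelWeilTensorGenerator
  (isStandardSectionFamily_swTensorTwisted continuous_swTensorTwisted)
open Summit.HodgeConjecture.HodgeConjecture.Cruxes.HLiu418.K2LiuTensorEmbArchFinParts (finiteDimensional_span_orbit_of_mem_span_tmul_of_isStd)

/-- **PIN′ PART A — (PIN′) FROM THE PINNED SOCKET #41.**  Hypothesis `h41p` = socket #41 `sig_K2LiuSiegelEisensteinContinuation` in its PINNED reading (K2E3-typ2 (g3)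
cert head `tieProbe_41pin_…` :296–:311 BYTES, `IdeleClassGroup` written qualified as in ★ p863086's by-value `h41`): every STANDARD section family `f` for `(𝒦, λ̃⁻¹)`,
continuous in `h`, has a continuation `Es` on `{0 < re s}` with the five clauses and `∏ p ∈ {½}, (s − p)`.  Conclusion = binder 0 `hpin'` of ★ p863161
`K2LiuHolOnSpanOfPoleSet.hHol''_of_poleSet'_and_vanishing`, BYTES VERBATIM (= typ3 v12 `slot_pinP`).  Proof: ONE application of `h41p` at the twisted Siegel–Weil family
`g_x` of `x ∈ D_V`, STANDARD by ★ `isStandardSectionFamily_swTensorTwisted` (`M₂ = 3`, `rw [hχD]`; `K`-finiteness ★ `finiteDimensional_span_orbit_of_mem_span_tmul_of_isStd …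
harch x.2` over ★ `isDoubledWeilRep_doubledWeilRep`) and continuous by ★ `continuous_swTensorTwisted`.
[cite: KudlaRallis1994, §1 Thm. 1.1] [cite: Tan1999, §1 Main Theorem p. 166] [cite: Liu2021, App. B Lem. B.10 (2) p. 102, Lem. B.12 pp. 103–104] -/
theorem pinPrime_of_pinnedSocket41
    (h41p :
      ∀ (L : Type) [Field L] [NumberField L] [IsCMField L] {n : ℕ} (e : Fin 2 × Fin 1 ≃ Fin n)
        (dV : Fin 2 → L) (hdV : ∀ i, IsCMField.complexConj L (dV i) = dV i) (hdV0 : ∀ i, dV i ≠ 0)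
        (dW : Fin 1 → L) (hdW : ∀ i, IsCMField.complexConj L (dW i) = dW i) (hdW0 : ∀ i, dW i ≠ 0)
        (lam : Literature.NumberTheory.Automorphic.IdeleClassGroup L →ₜ* Circle) (hlam : IsConjugateSymplectic L lam),
        HasWeight L lam 1 →
        ∀ (𝒦 : IwasawaDatum L e dV hdV dW hdW) (_h𝒦 : 𝒦.IsStd) (f : ℂ → HA L e dV hdV dW hdW → ℂ),
          IsStandardSectionFamily 𝒦 (toHeckeCharacter L lam⁻¹) f → (∀ s, Continuous (f s)) →
        ∃ Es : ℂ → HA L e dV hdV dW hdW → ℂ,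
          (∀ h : HA L e dV hdV dW hdW, DifferentiableOn ℂ (fun s => Es s h) {s : ℂ | 0 < s.re}) ∧
          (∀ s : ℂ, 0 < s.re → Continuous (Es s)) ∧
          (∀ s : ℂ, 0 < s.re → ∀ (γ : ratH L e dV hdV dW hdW) (h : HA L e dV hdV dW hdW),
            Es s ((γ : HA L e dV hdV dW hdW) * h) = Es s h) ∧
          (∀ (s : ℂ) (h : HA L e dV hdV dW hdW), (n : ℝ) / 2 < s.re →
            Es s h = (∏ p ∈ ({(1 / 2 : ℂ)} : Finset ℂ), (s - p)) * eisensteinFamilyDelta L e dV hdV dW hdW f s h) ∧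
          (∀ z : ℂ, 0 < z.re → ∃ C A r : ℝ, 0 < r ∧ ∀ s : ℂ, dist s z < r → ∀ h : HA L e dV hdV dW hdW,
            ‖Es s h‖ ≤ C * adelicHeightGL (n + n) L (h : GL (Fin (n + n)) (AdeleRing (𝓞 L) L)) ^ A)) :
    ∀ (L : Type) [Field L] [NumberField L] [IsCMField L] {n : ℕ} (e : Fin 2 × Fin 1 ≃ Fin n)
      (dV : Fin 2 → L) (hdV : ∀ i, IsCMField.complexConj L (dV i) = dV i) (hdV0 : ∀ i, dV i ≠ 0)
      (dW : Fin 1 → L) (hdW : ∀ i, IsCMField.complexConj L (dW i) = dW i) (hdW0 : ∀ i, dW i ≠ 0)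
      (lam : Literature.NumberTheory.Automorphic.IdeleClassGroup L →ₜ* Circle) (hlam : IsConjugateSymplectic L lam),
      HasWeight L lam 1 →
      ∀ {M' n' : ℕ} (eW : Fin 1 × Fin 3 ≃ Fin M') (e' : Fin 2 × Fin M' ≃ Fin n')
        (dV' : Fin 3 → L) (hdV' : ∀ k, IsCMField.complexConj L (dV' k) = dV' k) (hdV'0 : ∀ k, dV' k ≠ 0)
        (χb : HeckeCharacter L) (hχbu : χb.IsUnitary) (hχbs : Literature.RepresentationTheory.HarrisKudlaSweet1996.IsSplittingChar L 1 χb)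
        (α : UnitaryGroup.adelicOne (Fp L) L (IsCMField.complexConj L) →* ℂˣ) (hα : Continuous α)
        (hαrat : ∀ u : UnitaryGroup.adelicOne (Fp L) L (IsCMField.complexConj L),
          (u : Literature.NumberTheory.GaloisRepresentations.ideleGroup L) ∈ Literature.NumberTheory.GaloisRepresentations.principalIdeles L → α u = 1)
        (_hχD : χb ^ 3 * DoubledWeilDetTwist.ratioHecke L α hα hαrat = toHeckeCharacter L lam⁻¹)
        (𝒦 : IwasawaDatum L e dV hdV dW hdW) (_h𝒦 : 𝒦.IsStd),
        (¬ ∃ v : Fin 3 → L, v ≠ 0 ∧ ∑ k, dV' k * (v k * IsCMField.complexConj L (v k)) = 0) →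
        ∀ (V : Submodule ℂ 𝓢(((Fin (n' + n')) → mixedSpace (Fp L)), ℂ)), FiniteDimensional ℂ V →
          (∀ ainf : UnitaryGroup.arch (Fp L) L (IsCMField.complexConj L) (n + n) (hermD L e dV hdV dW hdW),
            (UnitaryGroup.archToAdelic (Fp L) L (IsCMField.complexConj L) (n + n) (hermD L e dV hdV dW hdW) ainf : HA L e dV hdV dW hdW) ∈ 𝒦.K →
            ∀ a ∈ V, ∃ a'' ∈ V, ∀ f : FinSB (Fp L) (Fin (n' + n')),
              adelicMpCont.omega (Fp L) (Fin (n' + n')) (gramDA L e' dV hdV (tensorFrame L dW eW dV') (tensorFrame_real L dW hdW eW dV' hdV'))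
                  ((doubledWeilRep L e' dV hdV hdV0 (tensorFrame L dW eW dV') (tensorFrame_real L dW hdW eW dV' hdV')
                        (tensorFrame_ne_zero L dW eW dV' hdW0 hdV'0) χb hχbu hχbs)
                    (tensorEmb L e dV hdV dW hdW eW e' dV' hdV'
                      (UnitaryGroup.archToAdelic (Fp L) L (IsCMField.complexConj L) (n + n) (hermD L e dV hdV dW hdW) ainf)))
                  (piSchwartzBruhatEquiv (Fp L) (Fin (n' + n')) (a ⊗ₜ[ℂ] f)) =
                piSchwartzBruhatEquiv (Fp L) (Fin (n' + n')) (a'' ⊗ₜ[ℂ] f)) →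
          ∀ (x : ↥(Submodule.span ℂ {x : piSchwartzBruhat (Fp L) (Fin (n' + n')) |
              ∃ a ∈ V, ∃ f : FinSB (Fp L) (Fin (n' + n')), x = piSchwartzBruhatEquiv (Fp L) (Fin (n' + n')) (a ⊗ₜ[ℂ] f)})), ∃ Es : ℂ → HA L e dV hdV dW hdW → ℂ,
            (∀ h : HA L e dV hdV dW hdW, DifferentiableOn ℂ (fun s => Es s h) {s : ℂ | 0 < s.re}) ∧
            (∀ s : ℂ, 0 < s.re → Continuous (Es s)) ∧
            (∀ s : ℂ, 0 < s.re → ∀ (γ : ratH L e dV hdV dW hdW) (h : HA L e dV hdV dW hdW),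
              Es s ((γ : HA L e dV hdV dW hdW) * h) = Es s h) ∧
            (∀ (s : ℂ) (h : HA L e dV hdV dW hdW), (n : ℝ) / 2 < s.re →
              Es s h = (∏ p ∈ ({(1 / 2 : ℂ)} : Finset ℂ), (s - p)) * eisensteinFamilyDelta L e dV hdV dW hdW
              (fun s₁ h₁ => ((DoubledWeilDetTwist.detChar L e dV hdV hdV0 dW hdW hdW0 α h₁ : ℂˣ) : ℂ) *
                stdExtension 𝒦 ((((3 : ℕ) : ℂ) - (n : ℂ)) / 2)
                  (swSectionTensor L e dV hdV dW hdW eW e' dV' hdV' hdV0 hdW0 hdV'0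
                    (doubledWeilRep L e' dV hdV hdV0 (tensorFrame L dW eW dV') (tensorFrame_real L dW hdW eW dV' hdV')
                      (tensorFrame_ne_zero L dW eW dV' hdW0 hdV'0) χb hχbu hχbs)
                    (x : piSchwartzBruhat (Fp L) (Fin (n' + n')))) s₁ h₁) s h) ∧
            (∀ z : ℂ, 0 < z.re → ∃ C A r : ℝ, 0 < r ∧ ∀ s : ℂ, dist s z < r → ∀ h : HA L e dV hdV dW hdW,
              ‖Es s h‖ ≤ C * adelicHeightGL (n + n) L (h : GL (Fin (n + n)) (AdeleRing (𝓞 L) L)) ^ A) := by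
  intro L _ _ _ n e dV hdV hdV0 dW hdW hdW0 lam hlam hwt M' n' eW e' dV' hdV' hdV'0 χb hχbu hχbs α hα hαrat hχD 𝒦 h𝒦 _hiso V hV harch x
  haveI := hV
  -- the frame letter: `doubledWeilRep χ_b` IS a `χ_b`-normalised doubled Weil representation (★ Liu2021 `Def411WeilCarriersDoubling`)
  have hsB := isDoubledWeilRep_doubledWeilRep L e' dV hdV hdV0 (tensorFrame L dW eW dV') (tensorFrame_real L dW hdW eW dV' hdV')
    (tensorFrame_ne_zero L dW eW dV' hdW0 hdV'0) χb hχbu hχbs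
  -- `K`-finiteness of `x ∈ D_V` under the standard compact of `𝒦` (★ U2f ⇒, from `harch` and `𝒦.IsStd`)
  have hKf := finiteDimensional_span_orbit_of_mem_span_tmul_of_isStd L e dV hdV dW hdW eW e' dV' hdV' hdV0 hdW0 hdV'0 h𝒦 hsB V harch x.2
  -- the twisted Siegel–Weil family of `x` is STANDARD for `(𝒦, λ̃⁻¹)` (★ O42.3g at `M₂ = 3`, character `χ_b³·α̃ = λ̃⁻¹` by `hχD`)
  have hstd : IsStandardSectionFamily 𝒦 (toHeckeCharacter L lam⁻¹)
      (fun s₁ h₁ => ((DoubledWeilDetTwist.detChar L e dV hdV hdV0 dW hdW hdW0 α h₁ : ℂˣ) : ℂ) *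
        stdExtension 𝒦 ((((3 : ℕ) : ℂ) - (n : ℂ)) / 2)
          (swSectionTensor L e dV hdV dW hdW eW e' dV' hdV' hdV0 hdW0 hdV'0
            (doubledWeilRep L e' dV hdV hdV0 (tensorFrame L dW eW dV') (tensorFrame_real L dW hdW eW dV' hdV')
              (tensorFrame_ne_zero L dW eW dV' hdW0 hdV'0) χb hχbu hχbs)
            (x : piSchwartzBruhat (Fp L) (Fin (n' + n')))) s₁ h₁) := by
    have key := isStandardSectionFamily_swTensorTwisted L e dV hdV hdV0 dW hdW hdW0 eW e' dV' hdV' hdV'0 α (by norm_num) hsB 𝒦 _ hKf hα hαrat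
    rw [hχD] at key
    exact key
  -- … and continuous in `h` for every `s` (★ `continuous_swTensorTwisted`)
  have hcont : ∀ s : ℂ, Continuous fun h₁ => ((DoubledWeilDetTwist.detChar L e dV hdV hdV0 dW hdW hdW0 α h₁ : ℂˣ) : ℂ) *
      stdExtension 𝒦 ((((3 : ℕ) : ℂ) - (n : ℂ)) / 2)
        (swSectionTensor L e dV hdV dW hdW eW e' dV' hdV' hdV0 hdW0 hdV'0
          (doubledWeilRep L e' dV hdV hdV0 (tensorFrame L dW eW dV') (tensorFrame_real L dW hdW eW dV' hdV')
            (tensorFrame_ne_zero L dW eW dV' hdW0 hdV'0) χb hχbu hχbs)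
          (x : piSchwartzBruhat (Fp L) (Fin (n' + n')))) s h₁ := fun s =>
    continuous_swTensorTwisted L e dV hdV hdV0 dW hdW hdW0 eW e' dV' hdV' hdV'0 α (by norm_num) hsB 𝒦 _ hKf hα s
  -- ONE application of the pinned socket #41
  exact h41p L e dV hdV hdV0 dW hdW hdW0 lam hlam hwt 𝒦 h𝒦 _ hstd hcont

end Summit.HodgeConjecture.HodgeConjecture.Cruxes.HLiu418.K2LiuPinPrimeOfPinnedSocket41

end
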